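import Mathlib.Data.Fintype.Card
import Literature.Algebra.EuclideanLattices.KhotRecoverable
import HarnessLib

/-!
# Khot 2005, §7.3: the size bookkeeping of the boosted and padded bases — the output is square

Topic `Algebra/EuclideanLattices`, namespace `Literature.Algebra.EuclideanLattices.Khot`. A small
brick of the decomposition of `Literature.Algebra.EuclideanLattices.gapSVP_const_isNPHardRandomized`
(pqc.S17) through `Khot2005_SAT_randReducible_gapSVP`: the cardinalities of the index types of the
boosted lattices (`KhotTensorBoost.Coef/Out`; §7.3: "the size of the `k`-wise augmented tensor
product lattice `L_k` has size at most `N' = N^{2k} × N^k`") and of the padded rows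
(`KhotRecoverable.augPad/basePad`), and the identity "columns + padded rows = rows" at every level
from the base identity, which yields the equivalences `eR, eC` to a common `Fin N` used by
`KhotGapInstance.squareOf`. All proved (elementary counting).

* `card_coef` (`|Coef n j| = |n|^{j+1}`), `card_out_succ`, `card_augPad_zero/succ`,
  `card_coef_add_card_augPad` (columns + padded = rows at every level, from the base),
  `card_basePad` (`= |U| - 1`), `card_base_cols_add_card_basePad` (the base identity for
  `finBasis (intBasis …)`: `(|S|+|N|+|H|+2) + (|U|-1) = |U|+|S|+|H|+|N|+1`).

## References

* S. Khot, *Hardness of approximating the shortest vector problem in lattices*, J. ACM 52 (2005)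
  789–808, §7.3 (size of the final instance).
-/

namespace Literature.Algebra.EuclideanLattices.Khot

open Finset

section Cards

variable {m n : Type} [Fintype m] [Fintype n]

/-- `|Coef n j| = |n|^{j+1}` (coefficient vectors of `L_{j+1}` are `N^{j+1}`-dimensional).
[cite: Khot2005, §7.3] -/
theorem card_coef (n : Type) [Fintype n] : ∀ j : ℕ, Fintype.card (Coef n j) = Fintype.card n ^ (j + 1)
  | 0 => (pow_one _).symm
  | j + 1 => by
    rw [show Fintype.card (Coef n (j + 1)) = Fintype.card (n × Coef n j) from rfl, Fintype.card_prod,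
      card_coef n j]
    ring

/-- `|Out m n (j+1)| = |m|·|Coef n j| + |m|·|Out m n j|` ("`MN' + MM'` co-ordinates", §6.2).
[cite: Khot2005, §6.2 and §7.3] -/
theorem card_out_succ (m n : Type) [Fintype m] [Fintype n] (j : ℕ) :
    Fintype.card (Out m n (j + 1)) =
      Fintype.card m * Fintype.card (Coef n j) + Fintype.card m * Fintype.card (Out m n j) := by
  rw [show Fintype.card (Out m n (j + 1)) = Fintype.card ((m × Coef n j) ⊕ (m × Out m n j)) from rfl,
    Fintype.card_sum, Fintype.card_prod, Fintype.card_prod]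

variable (p₀ : m → Prop) [DecidablePred p₀]

omit [Fintype n] in
/-- Padded rows at level `0` are the padded rows of the base. [folklore] -/
theorem card_augPad_zero :
    Fintype.card {o : Out m n 0 // augPad (n := n) p₀ 0 o} = Fintype.card {r : m // p₀ r} := rfl

/-- Padded rows at level `j+1`: the side rows over `p₀` and all main rows. [folklore] -/
theorem card_augPad_succ (j : ℕ) :
    Fintype.card {o : Out m n (j + 1) // augPad (n := n) p₀ (j + 1) o} =
      Fintype.card {r : m // p₀ r} * Fintype.card (Coef n j) + Fintype.card m * Fintype.card (Out m n j) := by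
  classical
  -- split the subtype of a sum along the two summands
  let e : {o : Out m n (j + 1) // augPad (n := n) p₀ (j + 1) o} ≃
      ({rc : m × Coef n j // p₀ rc.1} ⊕ (m × Out m n j)) :=
    { toFun := fun o => match o with
        | ⟨Sum.inl rc, h⟩ => Sum.inl ⟨rc, h⟩
        | ⟨Sum.inr mo, _⟩ => Sum.inr mo
      invFun := fun s => match s with
        | Sum.inl ⟨rc, h⟩ => ⟨Sum.inl rc, h⟩
        | Sum.inr mo => ⟨Sum.inr mo, trivial⟩
      left_inv := fun o => by rcases o with ⟨rc | mo, h⟩ <;> rfl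
      right_inv := fun s => by rcases s with ⟨rc, h⟩ | mo <;> rfl }
  rw [Fintype.card_congr e, Fintype.card_sum, Fintype.card_prod]
  congr 1
  -- `{rc : m × C // p₀ rc.1} ≃ {r // p₀ r} × C`
  let e' : {rc : m × Coef n j // p₀ rc.1} ≃ ({r : m // p₀ r} × Coef n j) :=
    { toFun := fun rc => (⟨rc.1.1, rc.2⟩, rc.1.2)
      invFun := fun p => ⟨(p.1.1, p.2), p.1.2⟩
      left_inv := fun rc => rfl
      right_inv := fun p => rfl }
  rw [Fintype.card_congr e', Fintype.card_prod]

/-- **Columns + padded rows = rows at every level**, from the base identity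
`|n| + |p₀| = |m|`. [folklore] -/
theorem card_coef_add_card_augPad (hbase : Fintype.card n + Fintype.card {r : m // p₀ r} = Fintype.card m) :
    ∀ j : ℕ, Fintype.card (Coef n j) + Fintype.card {o : Out m n j // augPad (n := n) p₀ j o} =
      Fintype.card (Out m n j)
  | 0 => by rw [card_augPad_zero]; exact hbase
  | j + 1 => by
    rw [card_augPad_succ, card_out_succ,
      show Fintype.card (Coef n (j + 1)) = Fintype.card (n × Coef n j) from rfl, Fintype.card_prod]
    have := card_coef_add_card_augPad hbase j
    nlinarith [hbase]

end Cards

section BaseCards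

variable {U S H Nn : Type} [Fintype U] [Fintype S] [Fintype H] [Fintype Nn] [DecidableEq U]

/-- The padded rows of Khot's base are the universe rows other than `e₀`: `|basePad e₀| = |U| - 1`.
[folklore] -/
theorem card_basePad (e₀ : U) :
    Fintype.card {i : ((U ⊕ S) ⊕ (H ⊕ Nn)) ⊕ Unit // basePad (S := S) (H := H) (Nn := Nn) e₀ i} =
      Fintype.card U - 1 := by
  classical
  let e : {i : ((U ⊕ S) ⊕ (H ⊕ Nn)) ⊕ Unit // basePad (S := S) (H := H) (Nn := Nn) e₀ i} ≃ {u : U // u ≠ e₀} :=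
    { toFun := fun i => match i with
        | ⟨Sum.inl (Sum.inl (Sum.inl e)), h⟩ => ⟨e, by obtain ⟨e', he', hne⟩ := h; cases he'; exact hne⟩
        | ⟨Sum.inl (Sum.inl (Sum.inr _)), h⟩ => (show False by obtain ⟨e', he', _⟩ := h; cases he').elim
        | ⟨Sum.inl (Sum.inr _), h⟩ => (show False by obtain ⟨e', he', _⟩ := h; cases he').elim
        | ⟨Sum.inr _, h⟩ => (show False by obtain ⟨e', he', _⟩ := h; cases he').elim
      invFun := fun u => ⟨Sum.inl (Sum.inl (Sum.inl u.1)), u.1, rfl, u.2⟩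
      left_inv := fun i => by
        rcases i with ⟨((e | j) | (r | c)) | x, h⟩
        · rfl
        all_goals exact (show False by obtain ⟨e', he', _⟩ := h; cases he').elim
      right_inv := fun u => rfl }
  rw [Fintype.card_congr e, Fintype.card_subtype_compl, Fintype.card_subtype_eq]

/-- **The base identity**: the columns of `finBasis (intBasis …)`, `(|S| + |N| + |H| + 1) + 1`,
together with the padded rows, `|U| - 1`, are as many as the rows, `(|U| + |S| + |H| + |N|) + 1`
(universe nonempty). [folklore] -/
theorem card_base_cols_add_card_basePad (e₀ : U) :
    Fintype.card (((S ⊕ (Nn ⊕ H)) ⊕ Unit) ⊕ Unit) +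
        Fintype.card {i : ((U ⊕ S) ⊕ (H ⊕ Nn)) ⊕ Unit // basePad (S := S) (H := H) (Nn := Nn) e₀ i} =
      Fintype.card (((U ⊕ S) ⊕ (H ⊕ Nn)) ⊕ Unit) := by
  rw [card_basePad e₀]
  simp only [Fintype.card_sum, Fintype.card_unit]
  have : 1 ≤ Fintype.card U := Fintype.card_pos_iff.2 ⟨e₀⟩
  omega

end BaseCards

end Literature.Algebra.EuclideanLattices.Khot
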